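import Summits.MatrixMultiplication.OmegaCensus.ThreeSetLineModFourSliceLemmas
import HarnessLib

/-!
# The bit-sliced MOD-4 FILTER, III: semantics of the masks, the sliced counters and the comparison

ω-census `pub-omega`, family (b3), seat pub-omega-group gen 42.  Framing: lottery ticket; floor = certified bounds/negative
ranges.  VALUE: a kernel TOOL for the three-set cube cells `(4, d, e)@p²` (`ThreeSetZpCells4Core`); NOT progress on ω.
`nzMask / ndMask`: a zero slice-bit certifies that a sliced vector is `0` / `δ₀` at that datum (the two convolution identities of
the inverse certificate); `passMask`: a zero slice-bit certifies that no hole passes; `valN` (the number carried by a sliced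
little-endian counter), `incFrom / incAt` (adding a bit, mod `2^width`), `digitSum` (`Σ_v val Y(v) mod 256`), `cmpC` (the
`< e` / `= e` masks), and `lt_digit_sum_of_holePass`: a zero bit of `holePass` means the digit sum exceeds `e` (`3p < 256`).
-/

namespace Summit.MatrixMultiplication.OmegaCensus

/-! # Semantics of the masks, the counters and the comparison -/

namespace LineMod

open Finset

/-! ## Masks -/

/-- A zero slice-bit of `nzMask f n` forces every digit `t < n` to vanish at that datum. [folklore] -/
theorem val2_eq_zero_of_nzMask {k : ℕ} (f : List S2) :
    ∀ n, (nzMask f n).testBit k = false → ∀ t < n, val2 k (vget f t) = 0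
  | 0, _, t, ht => absurd ht (Nat.not_lt_zero t)
  | n + 1, h, t, ht => by
    rw [nzMask, Nat.testBit_lor, Nat.testBit_lor, Bool.or_eq_false_iff, Bool.or_eq_false_iff] at h
    rcases Nat.lt_succ_iff_lt_or_eq.1 ht with ht' | rfl
    · exact val2_eq_zero_of_nzMask f n h.1.1 t ht'
    · unfold val2 bv; rw [h.1.2, h.2]; simp

/-- A zero slice-bit of `ndMask p ones f` (below `L`) forces `f = δ₀` at that datum. [folklore] -/
theorem val2_eq_delta_of_ndMask {k L p : ℕ} (hk : k < L) (f : List S2) (h : (ndMask p (onesOf L) f).testBit k = false) :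
    ∀ t < p, val2 k (vget f t) = if t = 0 then 1 else 0 := by
  intro t ht
  have h0 := val2_eq_zero_of_nzMask _ p h t ht
  rw [vget_range_map _ ht] at h0
  by_cases ht0 : t = 0
  · subst ht0
    rw [if_pos rfl] at h0
    rw [val2_add2, val2_ones_both hk] at h0
    rw [if_pos rfl]
    exact (sub_eq_zero.1 (by rw [sub_eq_add_neg]; exact h0))
  · rw [if_neg ht0] at h0 ⊢
    exact h0

/-- `passMask` step. [folklore] -/
theorem passMask_succ (p ones e : ℕ) (c0 : S2) (α' β' : List S2) (s : ℕ) :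
    passMask p ones e c0 α' β' (s + 1) = passMask p ones e c0 α' β' s ||| holePass p ones e c0 α' β' s := by
  rw [passMask]
  cases h : holePass p ones e c0 α' β' s with
  | zero => simp
  | succ m => rfl

/-- A zero slice-bit of `passMask … n` means no hole `s < n` passes at that datum. [folklore] -/
theorem holePass_false_of_passMask {k : ℕ} (p ones e : ℕ) (c0 : S2) (α' β' : List S2) :
    ∀ n, (passMask p ones e c0 α' β' n).testBit k = false → ∀ s < n, (holePass p ones e c0 α' β' s).testBit k = false
  | 0, _, s, hs => absurd hs (Nat.not_lt_zero s)
  | n + 1, h, s, hs => by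
    rw [passMask_succ, Nat.testBit_lor, Bool.or_eq_false_iff] at h
    rcases Nat.lt_succ_iff_lt_or_eq.1 hs with hs' | rfl
    · exact holePass_false_of_passMask p ones e c0 α' β' n h.1 s hs'
    · exact h.2

/-! ## Counters -/

/-- The natural number carried by datum `k` of a little-endian sliced counter. [folklore] -/
def valN (k : ℕ) : List ℕ → ℕ
  | [] => 0
  | c0 :: cs => (c0.testBit k).toNat + 2 * valN k cs

/-- `valN` is below `2^length`. [folklore] -/
theorem valN_lt (k : ℕ) : ∀ c : List ℕ, valN k c < 2 ^ c.length
  | [] => by simp [valN]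
  | c0 :: cs => by
    have := valN_lt k cs
    rw [valN, List.length_cons, pow_succ]
    cases c0.testBit k <;> simp <;> omega

/-- Length of `incFrom`. [folklore] -/
theorem length_incFrom : ∀ (c : List ℕ) (b : ℕ), (incFrom c b).length = c.length
  | [], _ => rfl
  | c0 :: cs, b => by rw [incFrom, List.length_cons, List.length_cons, length_incFrom]

/-- Length of `incAt`. [folklore] -/
theorem length_incAt : ∀ (c : List ℕ) (i b : ℕ), (incAt c i b).length = c.length
  | [], _, _ => by rw [incAt]
  | c0 :: cs, 0, b => by rw [incAt, length_incFrom]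
  | c0 :: cs, i + 1, b => by rw [incAt, List.length_cons, List.length_cons, length_incAt]

/-- A half adder on bits. [folklore] -/
theorem toNat_xor_add (x y : Bool) : (x ^^ y).toNat + 2 * (x && y).toNat = x.toNat + y.toNat := by
  cases x <;> cases y <;> rfl

/-- `(x + 2y) mod 2^(n+1) = x + 2 (y mod 2^n)` for a bit `x`. [folklore] -/
theorem bit_add_two_mul_mod (x y n : ℕ) (hx : x < 2) : (x + 2 * y) % 2 ^ (n + 1) = x + 2 * (y % 2 ^ n) := by
  rw [pow_succ, mul_comm (2 ^ n) 2, Nat.add_mod, Nat.mul_mod_mul_left,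
    Nat.mod_eq_of_lt (show x < 2 * 2 ^ n by have := Nat.one_le_two_pow (n := n); omega)]
  exact Nat.mod_eq_of_lt (by have := Nat.mod_lt y (Nat.two_pow_pos n); omega)

/-- **`incFrom` adds a bit** (mod `2^width`). [folklore] -/
theorem valN_incFrom (k : ℕ) : ∀ (c : List ℕ) (b : ℕ),
    valN k (incFrom c b) = (valN k c + (b.testBit k).toNat) % 2 ^ c.length
  | [], b => by simp [incFrom, valN, Nat.mod_one]
  | c0 :: cs, b => by
    rw [incFrom, valN, valN_incFrom k cs, Nat.testBit_xor, Nat.testBit_land, valN, List.length_cons,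
      show (c0.testBit k).toNat + 2 * valN k cs + (b.testBit k).toNat =
        ((c0.testBit k) ^^ (b.testBit k)).toNat + 2 * (valN k cs + ((c0.testBit k) && (b.testBit k)).toNat) by
        have := toNat_xor_add (c0.testBit k) (b.testBit k); omega,
      bit_add_two_mul_mod _ _ _ (by cases (c0.testBit k ^^ b.testBit k) <;> simp)]

/-- **`incAt` adds a bit at position `i`** (mod `2^width`). [folklore] -/
theorem valN_incAt (k : ℕ) : ∀ (c : List ℕ) (i b : ℕ),
    valN k (incAt c i b) = (valN k c + (b.testBit k).toNat * 2 ^ i) % 2 ^ c.length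
  | [], i, b => by simp [incAt, valN, Nat.mod_one]
  | c0 :: cs, 0, b => by rw [incAt, valN_incFrom, pow_zero, mul_one]
  | c0 :: cs, i + 1, b => by
    rw [incAt, valN, valN_incAt k cs i b, valN, List.length_cons,
      show (c0.testBit k).toNat + 2 * valN k cs + (b.testBit k).toNat * 2 ^ (i + 1) =
        (c0.testBit k).toNat + 2 * (valN k cs + (b.testBit k).toNat * 2 ^ i) by rw [pow_succ]; ring,
      bit_add_two_mul_mod _ _ _ (by cases c0.testBit k <;> simp)]

/-- Length of `digitSum`. [folklore] -/
theorem length_digitSum (Y : List S2) : ∀ n, (digitSum Y n).length = 8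
  | 0 => rfl
  | n + 1 => by rw [digitSum, length_incAt, length_incAt, length_digitSum Y n]

/-- **`digitSum`** carries `Σ_{v<n} val(Y v)` (mod 256). [folklore] -/
theorem valN_digitSum (k : ℕ) (Y : List S2) : ∀ n, valN k (digitSum Y n) = (∑ v ∈ range n, (val2 k (vget Y v)).val) % 256
  | 0 => by simp [digitSum, valN]
  | n + 1 => by
    rw [digitSum, valN_incAt, valN_incAt, length_incAt, length_digitSum, valN_digitSum k Y n, sum_range_succ,
      val_val2, pow_zero, pow_one, mul_one]
    norm_num [Nat.add_mod, Nat.mod_mod]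
    omega

/-- **`cmpC`** compares with the constant: `lt`/`eq` slice-bits (below `L`). [folklore] -/
theorem cmpC_spec {k L : ℕ} (hk : k < L) : ∀ (c : List ℕ) (e : ℕ),
    ((cmpC (onesOf L) c e).1.testBit k = decide (valN k c < e)) ∧
    ((cmpC (onesOf L) c e).2.testBit k = decide (valN k c = e))
  | [], e => by
    have hone : (onesOf L).testBit k = true := by unfold onesOf; rw [Nat.testBit_two_pow_sub_one]; simp [hk]
    unfold cmpC valN
    constructor
    · by_cases h : 0 < e
      · rw [if_pos h, hone]; simp [h]
      · rw [if_neg h, Nat.zero_testBit]; simp at h; simp [h]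
    · by_cases h : e = 0
      · rw [if_pos h, hone]; simp [h]
      · rw [if_neg h, Nat.zero_testBit]; exact (decide_eq_false fun h' => h h'.symm).symm
  | c0 :: cs, e => by
    have hone : (onesOf L).testBit k = true := by unfold onesOf; rw [Nat.testBit_two_pow_sub_one]; simp [hk]
    obtain ⟨ih1, ih2⟩ := cmpC_spec hk cs (e / 2)
    have he : e = e % 2 + 2 * (e / 2) := by omega
    rw [cmpC, valN]
    rcases Nat.mod_two_eq_zero_or_one e with h0 | h1
    · rw [if_neg (by omega)]
      dsimp only
      rw [ih1, Nat.testBit_land, ih2, Nat.testBit_xor, hone]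
      constructor
      · rw [Bool.eq_iff_iff, decide_eq_true_iff, decide_eq_true_iff]
        cases c0.testBit k <;> simp only [Bool.toNat_false, Bool.toNat_true] <;> omega
      · rw [Bool.eq_iff_iff, Bool.and_eq_true, decide_eq_true_iff, decide_eq_true_iff]
        cases c0.testBit k <;> simp only [Bool.toNat_false, Bool.toNat_true, Bool.xor_true, Bool.not_false,
          Bool.not_true, and_true, Bool.false_eq_true, and_false, false_iff] <;> omega
    · rw [if_pos h1]
      dsimp only
      rw [Nat.testBit_lor, Nat.testBit_land, Nat.testBit_land, ih1, ih2, Nat.testBit_xor, hone]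
      constructor
      · rw [Bool.eq_iff_iff, Bool.or_eq_true, Bool.and_eq_true, decide_eq_true_iff, decide_eq_true_iff,
          decide_eq_true_iff]
        cases c0.testBit k <;> simp only [Bool.toNat_false, Bool.toNat_true, Bool.xor_true, Bool.not_false,
          Bool.not_true, and_true, Bool.false_eq_true, and_false, or_false] <;> omega
      · rw [Bool.eq_iff_iff, Bool.and_eq_true, decide_eq_true_iff, decide_eq_true_iff]
        cases c0.testBit k <;> simp only [Bool.toNat_false, Bool.toNat_true, and_true, Bool.false_eq_true, and_false,
          false_iff] <;> omega

/-- **The hole test.**  A zero slice-bit of `holePass` (below `L`, `3p < 256`) means the digit sum of the hole vector at that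
datum EXCEEDS `e`. [folklore] -/
theorem lt_digit_sum_of_holePass {k L p e : ℕ} (hk : k < L) (hp : 3 * p < 256) (c0 : S2) (α' β' : List S2) (s : ℕ)
    (h : (holePass p (onesOf L) e c0 α' β' s).testBit k = false) :
    e < ∑ v ∈ range p, (val2 k (vget (holeVec p c0 α' β' s) v)).val := by
  unfold holePass at h
  dsimp only at h
  rw [Nat.testBit_lor, Bool.or_eq_false_iff] at h
  obtain ⟨h1, h2⟩ := cmpC_spec hk (digitSum (holeVec p c0 α' β' s) p) e
  rw [h.1] at h1
  rw [h.2] at h2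
  have hlt : ¬ valN k (digitSum (holeVec p c0 α' β' s) p) < e := fun hh => by simp [hh] at h1
  have heq : ¬ valN k (digitSum (holeVec p c0 α' β' s) p) = e := fun hh => by simp [hh] at h2
  rw [valN_digitSum] at hlt heq
  have hbound : ∑ v ∈ range p, (val2 k (vget (holeVec p c0 α' β' s) v)).val < 256 := by
    calc ∑ v ∈ range p, (val2 k (vget (holeVec p c0 α' β' s) v)).val ≤ ∑ _v ∈ range p, 3 :=
          sum_le_sum fun v _ => Nat.le_of_lt_succ (ZMod.val_lt _)
      _ = 3 * p := by rw [sum_const, card_range, smul_eq_mul, mul_comm]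
      _ < 256 := hp
  rw [Nat.mod_eq_of_lt hbound] at hlt heq
  omega

end LineMod

end Summit.MatrixMultiplication.OmegaCensus
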